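import Mathlib
import HarnessLib
import Summits.NavierStokesRegularity.NavierStokesRegularity.Theorems.LocalSineTubeDoorEnstrophyProductionProfileRigidity

/-!
# The one-window door family — a SIGNED Liouville theorem: Type-I profiles with NONPOSITIVE enstrophy production
# (vortex compression everywhere) are trivial

Cell ns-regularity-ideate, seat p6 (route-directed support for nsreg-p1's door family; anchor
`--supports stmt-NavierStokesRegularity-20018`).  Sequel of `…LocalSineTubeDoorEnstrophyProductionProfileRigidity` (p459001):
the maximum-principle argument there only uses the SIGN of the production.  For a profile of the family's Type-I class
(rate, continuity on the open slab, unit-viscosity Oseen–Duhamel identity, divergence-free slices):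

  **if `⟪curl v(s), Dv(s) curl v(s)⟫ ≤ 0` at every point of every slice `s < 0` (no vortex stretching anywhere, only
  compression or neutrality), then `v ≡ 0`** (`eq_zero_of_production_nonpos`).

Indeed by the pointwise enstrophy balance (`enstrophyDensity_balance`) `q = |ω|²` is then a bounded SUB-solution of
`∂ₜq + (v·∇)q − Δq ≤ 0` on every `[t₀, t₁] × ℝ³`, `t₁ < 0`, so `q(t₁, ·) ≤ sup q(t₀, ·) ≤ (C₂/(−t₀))² → 0`
(`…BoundedSubsolutionMaxPrinciple.le_of_bounded_subsolution`, class vorticity rate).  So a Type-I blow-up profile must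
STRETCH vorticity (`ω·Sω > 0`) somewhere on every time slab `(−∞, t₁)` — a Liouville-type statement on the profile
class itself (no window door is attached: an inequality on a window does not spread by analyticity).

* `enstrophy_subsolution_of_production_nonpos` — the sub-solution property;
* `curl_eq_zero_of_production_nonpos`, `eq_zero_of_production_nonpos`, `not_backwardSingular_of_production_nonpos`.

WHAT THIS IS NOT: not a claim about Navier–Stokes regularity (Clay A) — a settled SIGNED stratum of the family's profile
class (bears_on LADDER-NS N0, door family support); establishment in the cell's sense still requires the cross-family
referee PASS + independent reproduction.
-/

noncomputable section

-- the summit and its single sub-problem share the name (CONVENTIONS §1), as in every Theorems file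
set_option linter.dupNamespace false

namespace Summit.NavierStokesRegularity.NavierStokesRegularity.Theorems.LocalSineTubeDoorEnstrophyProductionSigned

open MeasureTheory Set Function Filter Topology TopologicalSpace Metric InnerProductSpace
open scoped RealInnerProductSpace InnerProductSpace Laplacian ContDiff
open Literature.Analysis Literature.Analysis.FluidPDE
open Summit.NavierStokesRegularity.NavierStokesRegularity.Theorems.LocalSineTubeDoorProfileAlignedWindowRigidityAncient
open Summit.NavierStokesRegularity.NavierStokesRegularity.Theorems.PoloidalWindowDoorPoloidalWindowRigidityWindow
open Summit.NavierStokesRegularity.NavierStokesRegularity.Theorems.PoloidalWindowDoorPoloidalWindowRigidityDegenerate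
open Summit.NavierStokesRegularity.NavierStokesRegularity.Theorems.PoloidalWindowDoorPoloidalWindowRigidityClassRate
open Summit.NavierStokesRegularity.NavierStokesRegularity.Theorems.LocalSineTubeDoorBoundedSubsolutionMaxPrinciple
open Summit.NavierStokesRegularity.NavierStokesRegularity.Theorems.LocalSineTubeDoorEnstrophyProductionProfileRigidity

variable {C : ℝ} {v : ℝ → EuclideanSpace ℝ (Fin 3) → EuclideanSpace ℝ (Fin 3)}

/-- **Under nonpositive production the enstrophy density is a sub-solution** of `∂ₜq + Dq(v) − Δq ≤ 0` at every point
of the open slab (two-sided time derivative), and `τ ↦ q(τ, x)` is differentiable there. -/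
theorem enstrophy_subsolution_of_production_nonpos (hrate : HasTypeITimeDecay C v)
    (hcont : ContinuousOn (uncurry v) (Iio (0 : ℝ) ×ˢ univ))
    (hmild : ∀ s t : ℝ, s < t → t < 0 → ∀ x,
      v t x = UnboundedOperators.heatExtension (v s) (t - s) x - oseenDuhamel 1 s v v t x)
    (hdiv : ∀ t < 0, VectorCalculus.IsDivFree (v t))
    (hprod : ∀ s < 0, ∀ y, ⟪curl (v s) y, fderiv ℝ (v s) y (curl (v s) y)⟫_ℝ ≤ 0) {t : ℝ} (ht : t < 0)
    (x : EuclideanSpace ℝ (Fin 3)) :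
    HasDerivAt (fun τ => ⟪curl (v τ) x, curl (v τ) x⟫_ℝ) (deriv (fun τ => ⟪curl (v τ) x, curl (v τ) x⟫_ℝ) t) t ∧
      deriv (fun τ => ⟪curl (v τ) x, curl (v τ) x⟫_ℝ) t +
          fderiv ℝ (fun y => ⟪curl (v t) y, curl (v t) y⟫_ℝ) x (v t x) -
          (Δ (fun y => ⟪curl (v t) y, curl (v t) y⟫_ℝ)) x ≤ 0 := by
  have hA : IsTypeIAncientMild C v := isTypeIAncientMild_of_class hrate hcont hmild hdiv
  have ht₀ : t - 1 < 0 := by linarith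
  have htI : t ∈ Ioo (t - 1) 0 := ⟨by linarith, ht⟩
  obtain ⟨p, hcl⟩ := hA.exists_isClassicalNSSolutionOn_Ioo ht₀
  have hbal := enstrophyDensity_balance isOpen_Ioo hcl htI x
  have hdω : HasDerivWithinAt (fun τ => vorticity v τ x) (timeDerivWithin (Ioo (t - 1) 0) (vorticity v) t x)
      (Ioo (t - 1) 0) t := by
    rw [timeDerivWithin_apply]
    exact ((hcl.smooth_velocity.isSmoothSpaceTimeOn_vorticity isOpen_Ioo.uniqueDiffOn).differentiableWithinAt_time
      htI x).hasDerivWithinAt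
  have hq : HasDerivAt (fun τ => ⟪curl (v τ) x, curl (v τ) x⟫_ℝ)
      (⟪vorticity v t x, timeDerivWithin (Ioo (t - 1) 0) (vorticity v) t x⟫_ℝ +
        ⟪timeDerivWithin (Ioo (t - 1) 0) (vorticity v) t x, vorticity v t x⟫_ℝ) t := by
    have h := (hdω.inner ℝ hdω).hasDerivAt (isOpen_Ioo.mem_nhds htI)
    simpa only [vorticity_apply] using h
  refine ⟨hq.differentiableAt.hasDerivAt, ?_⟩
  have hderiv : deriv (fun τ => ⟪curl (v τ) x, curl (v τ) x⟫_ℝ) t =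
      timeDerivWithin (Ioo (t - 1) 0) (fun τ y => ⟪curl (v τ) y, curl (v τ) y⟫_ℝ) t x := by
    rw [timeDerivWithin_apply, derivWithin_of_isOpen isOpen_Ioo htI]
  rw [hderiv]
  have h1 : (1 : ℝ) * (Δ (fun y => ⟪curl (v t) y, curl (v t) y⟫_ℝ)) x =
      (Δ (fun y => ⟪curl (v t) y, curl (v t) y⟫_ℝ)) x := one_mul _
  rw [← h1, hbal]
  have := frobeniusNormSq_nonneg (fderiv ℝ (curl (v t)) x)
  have := hprod t ht x
  linarith

/-- **Profiles of the class with NONPOSITIVE enstrophy production are irrotational**: the enstrophy density is a bounded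
sub-solution on every slab `[t₀, t₁] × ℝ³`, `t₁ < 0`, so by the whole-space maximum principle
`|ω(t₁, x)|² ≤ sup |ω(t₀, ·)|² ≤ (C₂/(−t₀))²`, which tends to `0` as `t₀ → −∞`. -/
theorem curl_eq_zero_of_production_nonpos (hrate : HasTypeITimeDecay C v)
    (hcont : ContinuousOn (uncurry v) (Iio (0 : ℝ) ×ˢ univ))
    (hmild : ∀ s t : ℝ, s < t → t < 0 → ∀ x,
      v t x = UnboundedOperators.heatExtension (v s) (t - s) x - oseenDuhamel 1 s v v t x)
    (hdiv : ∀ t < 0, VectorCalculus.IsDivFree (v t))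
    (hprod : ∀ s < 0, ∀ y, ⟪curl (v s) y, fderiv ℝ (v s) y (curl (v s) y)⟫_ℝ ≤ 0) :
    ∀ t < 0, ∀ x, curl (v t) x = 0 := by
  have hA : IsTypeIAncientMild C v := isTypeIAncientMild_of_class hrate hcont hmild hdiv
  obtain ⟨C₂, hC₂⟩ := exists_curl_rate_of_class hrate hcont hmild
  have hC₂0 : 0 ≤ C₂ := by
    have h := hC₂ (-1) (by norm_num) 0
    rw [neg_neg, div_one] at h
    exact (norm_nonneg _).trans h
  -- the enstrophy density and its time derivative
  set q : ℝ → EuclideanSpace ℝ (Fin 3) → ℝ := fun τ y => ⟪curl (v τ) y, curl (v τ) y⟫_ℝ with hqdef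
  set qt : ℝ → EuclideanSpace ℝ (Fin 3) → ℝ := fun τ y => deriv (fun τ' => q τ' y) τ with hqtdef
  have hsmω : IsSmoothSpaceTimeOn (Iio 0) (vorticity v) :=
    (show IsSmoothSpaceTimeOn (Iio 0) v from hA.contDiffOn).isSmoothSpaceTimeOn_vorticity isOpen_Iio.uniqueDiffOn
  intro t₁ ht₁ x₁
  -- `q(t₁, x₁) ≤ (C₂/(−t₀))²` for every `t₀ < t₁`
  have hkey : ∀ t₀ < t₁, q t₁ x₁ ≤ (C₂ / (-t₀)) ^ 2 := by
    intro t₀ ht₀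
    -- drift bound on `[t₀, t₁]`
    obtain ⟨B, hB⟩ := bdd_of_hasTypeITimeDecay hrate (-t₁ / 2) (by linarith)
    have hbA : ∀ t ∈ Icc t₀ t₁, ∀ x, ‖v t x‖ ≤ B := fun t ht x => hB t (by linarith [ht.2]) x
    -- continuity of `q` on the closed slab
    have hq_c : ContinuousOn (uncurry q) (Icc t₀ t₁ ×ˢ univ) := by
      have hωc : ContinuousOn (uncurry (vorticity v)) (Icc t₀ t₁ ×ˢ univ) :=
        hsmω.continuousOn.mono (prod_mono (fun t ht => lt_of_le_of_lt ht.2 ht₁) Subset.rfl)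
      have h : ContinuousOn (fun z => ⟪uncurry (vorticity v) z, uncurry (vorticity v) z⟫_ℝ) (Icc t₀ t₁ ×ˢ univ) :=
        hωc.inner hωc
      refine h.congr fun z _ => ?_
      simp only [hqdef, uncurry, vorticity_apply]
    -- smooth slices
    have hq2 : ∀ t ∈ Icc t₀ t₁, ContDiff ℝ 2 (q t) := fun t ht => by
      have htn : t < 0 := lt_of_le_of_lt ht.2 ht₁
      have hΩ : ContDiff ℝ 2 (curl (v t)) :=
        contDiff_curl (n := 2) (analyticOnNhd_slice hcont (bdd_of_hasTypeITimeDecay hrate) hmild htn).contDiff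
      exact hΩ.inner ℝ hΩ
    -- time derivative and the sub-solution inequality
    have hsub := fun t (ht : t ∈ Icc t₀ t₁) x =>
      enstrophy_subsolution_of_production_nonpos hrate hcont hmild hdiv hprod (lt_of_le_of_lt ht.2 ht₁) x
    have hqt : ∀ x, ∀ t ∈ Icc t₀ t₁, HasDerivAt (fun τ => q τ x) (qt t x) t := fun x t ht => (hsub t ht x).1
    have hlaw : ∀ t ∈ Icc t₀ t₁, ∀ x, qt t x + fderiv ℝ (q t) x (v t x) - (Δ (q t)) x ≤ 0 :=
      fun t ht x => (hsub t ht x).2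
    -- bounds
    have hqbd : ∀ t < 0, ∀ x, q t x ≤ (C₂ / (-t)) ^ 2 := fun t ht x => by
      simp only [hqdef, real_inner_self_eq_norm_sq]
      exact pow_le_pow_left₀ (norm_nonneg _) (hC₂ t ht x) 2
    have hbdd : ∀ t ∈ Icc t₀ t₁, ∀ x, |q t x| ≤ (C₂ / (-t₁)) ^ 2 := fun t ht x => by
      have htn : t < 0 := lt_of_le_of_lt ht.2 ht₁
      have hq0 : 0 ≤ q t x := by simp only [hqdef]; exact real_inner_self_nonneg
      rw [abs_of_nonneg hq0]
      refine (hqbd t htn x).trans ?_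
      have h1 : C₂ / (-t) ≤ C₂ / (-t₁) := div_le_div_of_nonneg_left hC₂0 (by linarith) (by linarith [ht.2])
      exact pow_le_pow_left₀ (div_nonneg hC₂0 (by linarith)) h1 2
    have hinit : ∀ x, q t₀ x ≤ (C₂ / (-t₀)) ^ 2 := fun x => hqbd t₀ (ht₀.trans ht₁) x
    exact le_of_bounded_subsolution ht₀ hbA hq_c hq2 hqt hlaw hbdd hinit t₁ ⟨ht₀.le, le_rfl⟩ x₁
  -- let `t₀ → −∞`
  have hq0 : 0 ≤ q t₁ x₁ := by simp only [hqdef]; exact real_inner_self_nonneg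
  have hqle : q t₁ x₁ ≤ 0 := by
    refine le_of_forall_pos_le_add fun η hη => ?_
    -- choose `t₀` with `(C₂/(−t₀))² ≤ η`: `−t₀ ≥ C₂/√η`, e.g. `t₀ = t₁ − 1 − C₂/√η`
    set t₀ : ℝ := t₁ - 1 - C₂ / Real.sqrt η with ht₀def
    have hsη : 0 < Real.sqrt η := Real.sqrt_pos.2 hη
    have hq' : 0 ≤ C₂ / Real.sqrt η := div_nonneg hC₂0 hsη.le
    have ht₀ : t₀ < t₁ := by rw [ht₀def]; linarith
    have hnt₀ : C₂ / Real.sqrt η ≤ -t₀ := by rw [ht₀def]; linarith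
    have hpos : 0 < -t₀ := by linarith
    have h1 : C₂ / (-t₀) ≤ Real.sqrt η := by
      rw [div_le_iff₀ hpos]
      calc C₂ = C₂ / Real.sqrt η * Real.sqrt η := by field_simp
        _ ≤ -t₀ * Real.sqrt η := mul_le_mul_of_nonneg_right hnt₀ hsη.le
        _ = Real.sqrt η * -t₀ := mul_comm _ _
    have h2 : (C₂ / (-t₀)) ^ 2 ≤ Real.sqrt η ^ 2 := pow_le_pow_left₀ (div_nonneg hC₂0 hpos.le) h1 2
    rw [Real.sq_sqrt hη.le] at h2
    linarith [hkey t₀ ht₀]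
  have hq00 : q t₁ x₁ = 0 := le_antisymm hqle hq0
  simpa only [hqdef, inner_self_eq_zero] using hq00

/-- **TYPE-I PROFILES WITH NONPOSITIVE ENSTROPHY PRODUCTION ARE TRIVIAL.** -/
theorem eq_zero_of_production_nonpos (hrate : HasTypeITimeDecay C v)
    (hcont : ContinuousOn (uncurry v) (Iio (0 : ℝ) ×ˢ univ))
    (hmild : ∀ s t : ℝ, s < t → t < 0 → ∀ x,
      v t x = UnboundedOperators.heatExtension (v s) (t - s) x - oseenDuhamel 1 s v v t x)
    (hdiv : ∀ t < 0, VectorCalculus.IsDivFree (v t))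
    (hprod : ∀ s < 0, ∀ y, ⟪curl (v s) y, fderiv ℝ (v s) y (curl (v s) y)⟫_ℝ ≤ 0) : ∀ t < 0, ∀ x, v t x = 0 :=
  eq_zero_of_irrotational hrate hcont hmild hdiv (curl_eq_zero_of_production_nonpos hrate hcont hmild hdiv hprod)

/-- **The vortex-compressing stratum of the family's profile class is settled**: such a profile is not
backward-singular. -/
theorem not_backwardSingular_of_production_nonpos (hrate : HasTypeITimeDecay C v)
    (hcont : ContinuousOn (uncurry v) (Iio (0 : ℝ) ×ˢ univ))
    (hmild : ∀ s t : ℝ, s < t → t < 0 → ∀ x,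
      v t x = UnboundedOperators.heatExtension (v s) (t - s) x - oseenDuhamel 1 s v v t x)
    (hdiv : ∀ t < 0, VectorCalculus.IsDivFree (v t))
    (hprod : ∀ s < 0, ∀ y, ⟪curl (v s) y, fderiv ℝ (v s) y (curl (v s) y)⟫_ℝ ≤ 0) :
    ¬ IsBackwardSingularPoint v 0 :=
  nonflatLiouville_of_irrotational hrate hcont hmild hdiv (curl_eq_zero_of_production_nonpos hrate hcont hmild hdiv hprod)

end Summit.NavierStokesRegularity.NavierStokesRegularity.Theorems.LocalSineTubeDoorEnstrophyProductionSigned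

end
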